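import Summits.CriticalPhenomena.PercolationContinuityZ3.Theorems.PercNearOneGluingNoHeavyLowerTailSahiStrongDaykin
import Literature.Combinatorics.Sahi2008.Functional
import Mathlib.Tactic
import HarnessLib

/-!
# `NoHeavyLowerTail` (crux stmt-CriticalPhenomena-4575), master-family line P1 (gen 28):
# the distinct-pairs Ahlswede–Daykin inequality under an FKG weight on a finite cube

Support file (seat `prim-masterthm-p1`, gen 28; `--supports stmt-CriticalPhenomena-4575`).  No definitions, no `sorry`, standard axioms.
Corollaries of `…SahiStrongDaykin.sq_sum_le_of_logSupermodular` (gen 28, Theorem A) in the language of the Sahi files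
(`Literature.Combinatorics.Sahi2008.IsFKGMeasure` on the Boolean lattice `Finset ι`):
* `sq_sum_le_of_isFKGMeasure`: for an FKG weight `μ` on `Finset ι` (nonnegative, log-supermodular; the total-mass-one field is not used) and any
  family `𝒮` of configurations, `(Σ_𝒮 μ)² ≤ Σ_𝒮 μ² + 2·μ(pairInfs 𝒮)·μ(pairSups 𝒮)` — i.e. the μ-mass of ordered pairs of DISTINCT members is at most
  twice (mass of their pairwise meets) × (mass of their pairwise joins);
* `sum_offDiag_le_of_isFKGMeasure`: the same with the left side written as `Σ_{(s,t) ∈ 𝒮.offDiag} μ s · μ t`.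
Memo `run/shared/lean/prim/prim-masterthm/FROM-prim-masterthm-p1-g28-STRONG-DAYKIN.md` §0. [this work]
-/

namespace Summit.CriticalPhenomena.PercolationContinuityZ3.Theorems.SahiStrongDaykin

open Finset
open Literature.Combinatorics.Sahi2008

variable {ι : Type*} [DecidableEq ι] [Fintype ι]

/-- **Distinct-pairs Ahlswede–Daykin under an FKG weight on the cube `Finset ι`.** [this work] -/
theorem sq_sum_le_of_isFKGMeasure {μ : Finset ι → ℝ} (hμ : IsFKGMeasure μ) (𝒮 : Finset (Finset ι)) :
    (∑ s ∈ 𝒮, μ s) ^ 2 ≤ ∑ s ∈ 𝒮, μ s ^ 2 + 2 * ((∑ s ∈ pairInfs 𝒮, μ s) * ∑ s ∈ pairSups 𝒮, μ s) := by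
  refine sq_sum_le_of_logSupermodular (univ : Finset ι) 𝒮 μ hμ.nonneg ?_ ?_
  · intro s _ t _
    have h := hμ.mul_le_mul s t
    simpa only [inf_eq_inter, sup_eq_union] using h
  · intro s _
    exact mem_powerset.2 (subset_univ s)

omit [Fintype ι] in
/-- The mass of ordered pairs of DISTINCT members, as a sum over `offDiag`. [this work] -/
theorem sum_offDiag_eq (𝒮 : Finset (Finset ι)) (μ : Finset ι → ℝ) :
    ∑ p ∈ 𝒮.offDiag, μ p.1 * μ p.2 = (∑ s ∈ 𝒮, μ s) ^ 2 - ∑ s ∈ 𝒮, μ s ^ 2 := by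
  have hprod : ∑ p ∈ 𝒮 ×ˢ 𝒮, μ p.1 * μ p.2 = (∑ s ∈ 𝒮, μ s) ^ 2 := by
    rw [sum_product, sq, sum_mul_sum]
  have hdiag : ∑ p ∈ 𝒮.diag, μ p.1 * μ p.2 = ∑ s ∈ 𝒮, μ s ^ 2 := by
    rw [diag, sum_map]
    exact sum_congr rfl fun s _ => by simp [sq]
  have hsplit : ∑ p ∈ 𝒮 ×ˢ 𝒮, μ p.1 * μ p.2 = ∑ p ∈ 𝒮.diag, μ p.1 * μ p.2 + ∑ p ∈ 𝒮.offDiag, μ p.1 * μ p.2 := by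
    rw [← diag_union_offDiag, sum_union (disjoint_diag_offDiag 𝒮)]
  linarith

/-- **Distinct-pairs Ahlswede–Daykin, pair form**: `Σ_{s ≠ t ∈ 𝒮} μ(s)μ(t) ≤ 2·μ(pairInfs 𝒮)·μ(pairSups 𝒮)` for an FKG weight. [this work] -/
theorem sum_offDiag_le_of_isFKGMeasure {μ : Finset ι → ℝ} (hμ : IsFKGMeasure μ) (𝒮 : Finset (Finset ι)) :
    ∑ p ∈ 𝒮.offDiag, μ p.1 * μ p.2 ≤ 2 * ((∑ s ∈ pairInfs 𝒮, μ s) * ∑ s ∈ pairSups 𝒮, μ s) := by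
  rw [sum_offDiag_eq]
  have := sq_sum_le_of_isFKGMeasure hμ 𝒮
  linarith

end Summit.CriticalPhenomena.PercolationContinuityZ3.Theorems.SahiStrongDaykin
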